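import Mathlib.Analysis.SpecialFunctions.Log.Basic
import Mathlib.Analysis.SpecialFunctions.Exp
import Mathlib.Analysis.Complex.Exponential
import Mathlib.Analysis.Complex.ExponentialBounds
import Mathlib.Analysis.Real.Pi.Bounds

/-!
# The budget of the effective window `εM ≤ 1/19` with the certified bump ratio (pure real arithmetic)
(crux `WeilComb.CombShapePositivity`, item stmt-RiemannHypothesis-11229, line `Sketch`, towards `stub_windowCore`)

This is the arithmetic assembly of Theorem B's effective window in the shape of the skeleton's `stub_assemble40` /
`assemble_inv25`, with the Helson-potential constant `3/20` (`helsonPotential_le_three_twentieths`) AND the certified bump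
ratio `I₀² ≤ (153/100)N₀` (`integral_shapeBump_sq_le`, in place of Cauchy–Schwarz `I₀² ≤ 2N₀`); with the parameters
re-optimised (`θ = 33/20`, `η = 26/5`) the threshold is `εM ≤ 1/19` — the last rung this architecture reaches with these constants
(at `1/18` both coefficients are negative). Inputs (all hypotheses, named as in the skeleton; `U = ε⁻¹N`, `λ = εM`, `X = ε(1 + log M)Q₁`):
exact identity `ReQ = ReP − U·H + (L·Wd + Off)`, `H = V − D`, `V ≤ (log M + 3/20)L`;
pole `ReP ≥ −2F₀F₁‖A₋‖‖A₊‖`, `F₀,F₁ ≤ e^{ε/2}I`, `‖A₋‖² ≤ (1 + log M)L`, `‖A₊‖² ≤ M Q₁`;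
bathtub diagonal `Wd ≥ U(log(U/(2I²)) − 1) − (21/5π)I²`; weighted-Schur off-diagonal
`Off ≥ −I² e^ε (1 − (e^{4ε}−1)M/2)⁻¹ (1 + log M)Q₁`; `(log M + 1)Q₁ ≤ Q' + ML`; Poincaré
`Q' ≤ (1+η)MD + (1+1/η)(23/20)ML` (used at `η = 26/5`); `I² ≤ (153/100)N`.
Budget (θ = 33/20): per unit `U`,
`L·(log(950/153) − 23/20 − (3213/1570)ε − (1923669/722000)λ − c_X(1233/520)λ) + D·(1 − (31/5)c_Xλ) ≥ 0`,
`c_X = 19431/19855 + 6477/3500 ≈ 2.829`, using `e^ε ≤ 381/361`, `(1 − (e^{4ε}−1)M/2)⁻¹ ≤ 361/315`, `π > 3.14`,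
`log(950/153) > 91/50` (`e⁹¹ < (950/153)⁵⁰`); at `ε, λ ≤ 1/19` the two coefficients are `≥ 0.068` and `≥ 0.076`.
-/

noncomputable section

-- the sub-problem path `RiemannHypothesis/RiemannHypothesis` (single-conjunct summit, D-0017) duplicates a namespace
set_option linter.dupNamespace false

namespace Summit.RiemannHypothesis.RiemannHypothesis.Theorems.WeilCombBohrFejer

/-- `91/50 < log(950/153)` (`e⁹¹ < (950/153)⁵⁰`). [folklore] -/
theorem log_950_div_153_gt : (91 / 50 : ℝ) < Real.log (950 / 153) := by
  rw [Real.lt_log_iff_exp_lt (by norm_num)]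
  have h1 : Real.exp (91 / 50) ^ 50 = Real.exp 1 ^ 91 := by
    rw [← Real.exp_nat_mul, ← Real.exp_nat_mul]
    norm_num
  have h2 : Real.exp 1 ^ 91 < (950 / 153 : ℝ) ^ 50 := by
    have := Real.exp_one_lt_d9
    have h0 : (0 : ℝ) ≤ Real.exp 1 := (Real.exp_pos 1).le
    calc Real.exp 1 ^ 91 ≤ (2.7182818286 : ℝ) ^ 91 := by gcongr
      _ < (950 / 153 : ℝ) ^ 50 := by norm_num
  rw [← h1] at h2
  exact lt_of_pow_lt_pow_left₀ 50 (by norm_num) h2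

/-- **Budget of the effective window `εM ≤ 1/19`.** The arithmetic assembly of Theorem B's effective window
(skeleton `stub_assemble40` with the Helson constant `3/20` and the bump ratio `153/100`, `θ = 33/20`, `η = 26/5`): the
listed one-sided bounds imply `0 ≤ Re Q`. [folklore] -/
theorem assemble_inv19 : ∀ {ε Mr N I L D Qp Q1 V H ReQ ReP Wd Off F0 F1 nAm nAp : ℝ},
    0 < ε → 1 ≤ Mr → ε * Mr ≤ 1 / 19 →
    0 < N → 0 < I → I ^ 2 ≤ 153 / 100 * N →
    0 ≤ L → 0 ≤ D → 0 ≤ Q1 →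
    (Real.log Mr + 1) * Q1 ≤ Qp + Mr * L →
    (∀ η : ℝ, 0 < η → Qp ≤ (1 + η) * Mr * D + (1 + 1 / η) * (23 / 20) * Mr * L) →
    V ≤ (Real.log Mr + 3 / 20) * L → H = V - D →
    ReQ = ReP - ε⁻¹ * N * H + (L * Wd + Off) →
    0 ≤ F1 → F0 ≤ Real.exp (ε / 2) * I → F1 ≤ Real.exp (ε / 2) * I →
    0 ≤ nAm → 0 ≤ nAp → nAm ^ 2 ≤ (1 + Real.log Mr) * L → nAp ^ 2 ≤ Mr * Q1 →
    -(2 * (F0 * F1 * (nAm * nAp))) ≤ ReP →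
    ε⁻¹ * N * (Real.log (ε⁻¹ * N / (2 * I ^ 2)) - 1) - 21 / (5 * Real.pi) * I ^ 2 ≤ Wd →
    -(I ^ 2 * Real.exp ε * (1 - (Real.exp (4 * ε) - 1) * Mr / 2)⁻¹ * (1 + Real.log Mr) * Q1) ≤ Off →
    0 ≤ ReQ := by
  intro ε Mr N I L D Qp Q1 V H ReQ ReP Wd Off F0 F1 nAm nAp hε hMr hlam hN hI hI2 hL hD hQ1 hQ1le hPoinc hV hH
    hReQ hF1 hF0le hF1le hnAm hnAp hnAm2 hnAp2 hP hWd hOff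
  -- basic quantities
  have hMr0 : 0 < Mr := by linarith
  have hlam0 : 0 < ε * Mr := mul_pos hε hMr0
  have hε25 : ε ≤ 1 / 19 := by
    have : ε * 1 ≤ ε * Mr := mul_le_mul_of_nonneg_left hMr hε.le
    linarith
  have hεsq : ε * ε ≤ ε * (1 / 19) := mul_le_mul_of_nonneg_left hε25 hε.le
  have hlogMr : 0 ≤ Real.log Mr := Real.log_nonneg hMr
  set U : ℝ := ε⁻¹ * N with hU
  have hU0 : 0 < U := by positivity
  have hNU : N = ε * U := by rw [hU]; field_simp
  set X : ℝ := ε * (1 + Real.log Mr) * Q1 with hX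
  have hX0 : 0 ≤ X := by positivity
  have hI2U : I ^ 2 ≤ 153 / 100 * (ε * U) := by rw [← hNU]; exact hI2
  have hI2ε : I ^ 2 / ε ≤ 153 / 100 * U := by
    rw [div_le_iff₀ hε]; linarith
  -- exponential bounds
  have hexp : Real.exp ε ≤ 381 / 361 := by
    have h0 : |ε| ≤ 1 := by rw [abs_of_pos hε]; linarith
    have h := (abs_le.1 (Real.abs_exp_sub_one_sub_id_le h0)).2
    have e : ε ^ 2 = ε * ε := by ring
    rw [e] at h
    linarith
  have hexp0 : 0 ≤ Real.exp ε := (Real.exp_pos ε).le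
  have hexp4 : Real.exp (4 * ε) - 1 ≤ 92 / 19 * ε := by
    have h0 : |4 * ε| ≤ 1 := by rw [abs_of_pos (by positivity)]; linarith
    have h := (abs_le.1 (Real.abs_exp_sub_one_sub_id_le h0)).2
    have e : (4 * ε) ^ 2 = 16 * (ε * ε) := by ring
    rw [e] at h
    linarith
  have hexp4' : 0 ≤ Real.exp (4 * ε) - 1 := by linarith [Real.add_one_le_exp (4 * ε)]
  -- the Schur denominator
  set den : ℝ := 1 - (Real.exp (4 * ε) - 1) * Mr / 2 with hden
  have hden_lo : 315 / 361 ≤ den := by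
    have h1 : (Real.exp (4 * ε) - 1) * Mr ≤ 92 / 19 * ε * Mr := mul_le_mul_of_nonneg_right hexp4 hMr0.le
    have h2 : 92 / 19 * ε * Mr ≤ 92 / 361 := by
      have e : 92 / 19 * ε * Mr = 92 / 19 * (ε * Mr) := by ring
      rw [e]; linarith
    rw [hden]; linarith
  have hden0 : 0 < den := by linarith
  have hdeninv : den⁻¹ ≤ 361 / 315 := by
    rw [inv_le_comm₀ hden0 (by norm_num)]
    norm_num
    linarith
  -- (1) off-diagonal: `Off ≥ −(6477/3500)·U·X`
  have hOff1 : I ^ 2 * Real.exp ε * den⁻¹ * (1 + Real.log Mr) * Q1 ≤ 6477 / 3500 * U * X := by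
    have hcoef : Real.exp ε * den⁻¹ ≤ 127 / 105 := by
      calc Real.exp ε * den⁻¹ ≤ (381 / 361) * (361 / 315) :=
            mul_le_mul hexp hdeninv (inv_nonneg.2 hden0.le) (by norm_num)
        _ = 127 / 105 := by norm_num
    have h1 : I ^ 2 * ((1 + Real.log Mr) * Q1) ≤ 153 / 100 * U * X := by
      have e1 : (1 + Real.log Mr) * Q1 = X / ε := by
        rw [hX]; field_simp
      rw [e1, show I ^ 2 * (X / ε) = I ^ 2 / ε * X by ring]
      exact mul_le_mul_of_nonneg_right hI2ε hX0
    calc I ^ 2 * Real.exp ε * den⁻¹ * (1 + Real.log Mr) * Q1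
        = (Real.exp ε * den⁻¹) * (I ^ 2 * ((1 + Real.log Mr) * Q1)) := by ring
      _ ≤ (127 / 105) * (153 / 100 * U * X) := mul_le_mul hcoef h1 (by positivity) (by norm_num)
      _ = 6477 / 3500 * U * X := by ring
  have hOff2 : -(6477 / 3500 * U * X) ≤ Off := by linarith
  -- (2) pole: AM–GM `2ε‖A₋‖‖A₊‖ ≤ (33/20)λL + (20/33)X`, then `F₀F₁ ≤ e^ε I² ≤ (153/100)e^ε εU`
  have hA2 : (ε * (nAm * nAp)) ^ 2 ≤ ε * Mr * L * X := by
    have h1 : (nAm * nAp) ^ 2 ≤ ((1 + Real.log Mr) * L) * (Mr * Q1) := by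
      rw [mul_pow]; exact mul_le_mul hnAm2 hnAp2 (by positivity) (by positivity)
    calc (ε * (nAm * nAp)) ^ 2 = ε ^ 2 * (nAm * nAp) ^ 2 := by ring
      _ ≤ ε ^ 2 * (((1 + Real.log Mr) * L) * (Mr * Q1)) := mul_le_mul_of_nonneg_left h1 (by positivity)
      _ = ε * Mr * L * X := by rw [hX]; ring
  have hAMGM : 2 * (ε * (nAm * nAp)) ≤ 33 / 20 * (ε * Mr * L) + 20 / 33 * X := by
    apply le_of_sq_le_sq _ (by positivity)
    have e1 : (2 * (ε * (nAm * nAp))) ^ 2 = 4 * (ε * (nAm * nAp)) ^ 2 := by ring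
    have e2 : (33 / 20 * (ε * Mr * L) + 20 / 33 * X) ^ 2 =
        4 * (ε * Mr * L * X) + (33 / 20 * (ε * Mr * L) - 20 / 33 * X) ^ 2 := by ring
    rw [e1, e2]
    linarith [hA2, sq_nonneg (33 / 20 * (ε * Mr * L) - 20 / 33 * X)]
  have hF : F0 * F1 ≤ Real.exp ε * I ^ 2 := by
    have e : Real.exp (ε / 2) * Real.exp (ε / 2) = Real.exp ε := by
      rw [← Real.exp_add]; ring_nf
    calc F0 * F1 ≤ (Real.exp (ε / 2) * I) * (Real.exp (ε / 2) * I) :=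
          mul_le_mul hF0le hF1le hF1 (by positivity)
      _ = (Real.exp (ε / 2) * Real.exp (ε / 2)) * I ^ 2 := by ring
      _ = Real.exp ε * I ^ 2 := by rw [e]
  have hP1 : 2 * (F0 * F1 * (nAm * nAp)) ≤ U * (1923669 / 722000 * (ε * Mr * L) + 19431 / 19855 * X) := by
    have hrhs0 : 0 ≤ 33 / 20 * (ε * Mr * L) + 20 / 33 * X := by positivity
    calc 2 * (F0 * F1 * (nAm * nAp)) = (F0 * F1) * (2 * (ε * (nAm * nAp))) / ε := by
          field_simp
      _ ≤ (Real.exp ε * I ^ 2) * (33 / 20 * (ε * Mr * L) + 20 / 33 * X) / ε := by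
          apply div_le_div_of_nonneg_right _ hε.le
          exact mul_le_mul hF hAMGM (by positivity) (by positivity)
      _ = Real.exp ε * (I ^ 2 / ε) * (33 / 20 * (ε * Mr * L) + 20 / 33 * X) := by ring
      _ ≤ (381 / 361) * (153 / 100 * U) * (33 / 20 * (ε * Mr * L) + 20 / 33 * X) := by
          apply mul_le_mul_of_nonneg_right _ hrhs0
          exact mul_le_mul hexp hI2ε (by positivity) (by norm_num)
      _ = U * (1923669 / 722000 * (ε * Mr * L) + 19431 / 19855 * X) := by ring
  have hP2 : -(U * (1923669 / 722000 * (ε * Mr * L) + 19431 / 19855 * X)) ≤ ReP := by linarith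
  -- (3) Helson: `−U·H ≥ −U(log M + 3/20)L + U·D`
  have hH2 : -(U * H) ≥ -(U * ((Real.log Mr + 3 / 20) * L)) + U * D := by
    have := mul_le_mul_of_nonneg_left hV hU0.le
    rw [hH, mul_sub]
    linarith
  -- (4) diagonal: `log(U/(2I²)) ≥ log(950/153) + log M`
  have hkey : Real.log (950 / 153) + Real.log Mr ≤ Real.log (U / (2 * I ^ 2)) := by
    rw [← Real.log_mul (by norm_num) hMr0.ne']
    apply Real.log_le_log (by positivity)
    rw [le_div_iff₀ (by positivity)]
    have h1 : 950 / 153 * Mr * (2 * I ^ 2) ≤ 19 * (ε * Mr) * U :=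
      calc 950 / 153 * Mr * (2 * I ^ 2) = (1900 / 153 * Mr) * I ^ 2 := by ring
        _ ≤ (1900 / 153 * Mr) * (153 / 100 * (ε * U)) := mul_le_mul_of_nonneg_left hI2U (by positivity)
        _ = 19 * (ε * Mr) * U := by ring
    have h2 : 19 * (ε * Mr) * U ≤ U := by
      have := mul_le_mul_of_nonneg_right hlam hU0.le
      linarith
    linarith
  have hpi := Real.pi_gt_d2
  have hWd2 : U * (Real.log (950 / 153) + Real.log Mr - 1) - 3213 / 1570 * (ε * U) ≤ Wd := by
    have h1 : U * (Real.log (950 / 153) + Real.log Mr - 1) ≤ U * (Real.log (U / (2 * I ^ 2)) - 1) :=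
      mul_le_mul_of_nonneg_left (by linarith) hU0.le
    have h2 : 21 / (5 * Real.pi) * I ^ 2 ≤ 3213 / 1570 * (ε * U) := by
      have h3 : 21 / (5 * Real.pi) ≤ 21 / (5 * 3.14) :=
        div_le_div_of_nonneg_left (by norm_num) (by norm_num) (by linarith)
      calc 21 / (5 * Real.pi) * I ^ 2 ≤ (21 / (5 * 3.14)) * (153 / 100 * (ε * U)) :=
            mul_le_mul h3 hI2U (by positivity) (by positivity)
        _ = 3213 / 1570 * (ε * U) := by ring
    linarith
  have hWd3 : L * (U * (Real.log (950 / 153) + Real.log Mr - 1) - 3213 / 1570 * (ε * U)) ≤ L * Wd :=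
    mul_le_mul_of_nonneg_left hWd2 hL
  -- (5) the budget quantities `λL`, `λD`, `εL` and the Poincaré bound on `X`
  have hXle : X ≤ 31 / 5 * (ε * Mr * D) + 1233 / 520 * (ε * Mr * L) := by
    have h1 : X ≤ ε * Qp + ε * Mr * L := by
      have := mul_le_mul_of_nonneg_left hQ1le hε.le
      have e1 : X = ε * ((Real.log Mr + 1) * Q1) := by rw [hX]; ring
      have e2 : ε * (Qp + Mr * L) = ε * Qp + ε * Mr * L := by ring
      rw [e1]; rw [e2] at this; exact this
    have h2 : ε * Qp ≤ 31 / 5 * (ε * Mr * D) + 713 / 520 * (ε * Mr * L) := by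
      have hP5 := hPoinc (26 / 5) (by norm_num)
      have := mul_le_mul_of_nonneg_left hP5 hε.le
      have e : ε * ((1 + 26 / 5) * Mr * D + (1 + 1 / (26 / 5)) * (23 / 20) * Mr * L) =
          31 / 5 * (ε * Mr * D) + 713 / 520 * (ε * Mr * L) := by ring
      rw [e] at this; exact this
    linarith
  have hLL : ε * Mr * L ≤ 1 / 19 * L := mul_le_mul_of_nonneg_right hlam hL
  have hLD : ε * Mr * D ≤ 1 / 19 * D := mul_le_mul_of_nonneg_right hlam hD
  have hEL : ε * L ≤ 1 / 19 * L := mul_le_mul_of_nonneg_right hε25 hL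
  have hLL0 : 0 ≤ ε * Mr * L := by positivity
  have hLD0 : 0 ≤ ε * Mr * D := by positivity
  have hEL0 : 0 ≤ ε * L := by positivity
  have hlog := log_950_div_153_gt
  -- (6) the per-unit-`U` budget
  set Φ : ℝ := L * (Real.log (950 / 153) - 23 / 20) - 3213 / 1570 * (ε * L) - 1923669 / 722000 * (ε * Mr * L) + D -
      (19431 / 19855 + 6477 / 3500) * X with hΦ
  have hLlog : 91 / 50 * L ≤ Real.log (950 / 153) * L := mul_le_mul_of_nonneg_right hlog.le hL
  have hΦ0 : 0 ≤ Φ := by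
    rw [hΦ]
    linarith [hXle, hLL, hLD, hEL, hLL0, hLD0, hEL0, hLlog, hL, hD, hX0]
  have hsum : U * Φ ≤ ReQ := by
    have e : U * Φ = -(U * (1923669 / 722000 * (ε * Mr * L) + 19431 / 19855 * X)) +
        (-(U * ((Real.log Mr + 3 / 20) * L)) + U * D) +
        L * (U * (Real.log (950 / 153) + Real.log Mr - 1) - 3213 / 1570 * (ε * U)) +
        -(6477 / 3500 * U * X) := by
      rw [hΦ]; ring
    rw [hReQ, e]
    linarith [hP2, hH2, hWd3, hOff2]
  exact le_trans (mul_nonneg hU0.le hΦ0) hsum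

end Summit.RiemannHypothesis.RiemannHypothesis.Theorems.WeilCombBohrFejer

end
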